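import Literature.NumberTheory.EllipticCurves.BSDSelmerSmithIsogenyProofs
import Literature.NumberTheory.EllipticCurves.BSDSelmerSmithRootNumberDensityProofs
import HarnessLib

/-!
# Smith's isogeny trick: Thm. 1.17 for `E` and for `E₀` + Prop. 1.18 ⇒ Thm. 1.7 (arXiv:2503.17619, §1.2)

A `…Proofs` companion (theorems only: no definition, no named fact, no instance) of
`Literature.NumberTheory.EllipticCurves.BSDSelmer` §bsd.S34 (`smith_selmerCorank_density`:
A. Smith, *The Birch and Swinnerton-Dyer conjecture implies Goldfeld's conjecture*,
arXiv:2503.17619 (2025), Thm. 1.1).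

Up to theorems already in the tree, Thm. 1.1 for an elliptic `W / ℚ` *is* the statement
"`r_{2^∞}(W^d) ≤ 1` for `100 %` of the squarefree `d`"
(`smith_selmerCorank_density_iff_le_one_of_exists_isNewformOf`, granted Modularity and Monsky's
`2`-parity congruence), and that statement is an isogeny invariant
(`selmerCorankTwoInfty_quadraticTwist_intCast_eq_of_isIsogenous`: `r_{2^∞}(E^d) = r_{2^∞}(E₀^d)`,
the first equality of Prop. 1.18). For the curves with a balanced isogeny (Cases IV and V of
Def. 1.6) Smith obtains it (Thm. 1.7) not directly but through the **isogeny trick of §1.2**: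
the higher-Selmer machinery only yields the dichotomy of **Thm. 1.17** — for `100 %` of `d`,
either `r_{2^∞}(E^d) ≤ 1` or `r_{2^∞}(E^d) = r_{φ,div}(E^d) ≥ 2` (Case IV, `φ` the balanced
isogeny; in Case V a three-way dichotomy with `φ₁`, `φ₂`) — and the bad alternative is excluded
by playing Thm. 1.17 for `E` against Thm. 1.17 for the isogenous curve `E₀`, using the rank
identity of **Prop. 1.18**: for a degree-`2` `ℚ`-isogeny `φ : E → E₀` with dual `φ'` and `d ≠ 0`,
`r_{2^∞}(E^d) = r_{2^∞}(E₀^d) = r_{φ,div}(E^d) + r_{φ',div}(E₀^d)`.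
The printed deduction (proof of Thm. 1.7, end of §1.2) is by contradiction on a set of
positive proportion; run forward it reads: on the intersection of the two density-`1` sets of
Thm. 1.17 (for `E` with `φ`, for `E₀` with `φ'`), if `r_{2^∞}(E^d) ≥ 2` then
`r_{2^∞}(E^d) = r_{φ,div}(E^d)`, so `r_{φ',div}(E₀^d) = 0` by Prop. 1.18, while
`r_{2^∞}(E₀^d) = r_{2^∞}(E^d) ≥ 2` forces `r_{2^∞}(E₀^d) = r_{φ',div}(E₀^d) ≥ 2` — absurd; hence
`r_{2^∞}(E^d) ≤ 1` on a set of density `1`.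

This file **proves that deduction** for the tree's objects (`twistDensity`,
`selmerCorankTwoInfty`, `quadraticTwist`, `IsIsogenous`):

* `twistDensity_le_one_of_rank_identity`, `twistDensity_le_one_of_rank_identity₂` — the
  bookkeeping in the abstract (rank functions `ℤ → ℕ`; Case IV shape with one isogeny, Case V
  shape with two);
* `twistDensity_selmerCorankTwoInfty_le_one_iff_of_isIsogenous` — the core statement
  "`r_{2^∞}(E^d) ≤ 1` for `100 %` of `d`" is an isogeny invariant (the "we may assume, by
  considering the isogenous curve" step opening the proof of Thm. 1.7);
* `twistDensity_selmerCorankTwoInfty_le_one_of_isogenyTrick` (Case IV shape) and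
  `twistDensity_selmerCorankTwoInfty_le_one_of_isogenyTrick₂` (Case V shape): for `ℚ`-isogenous
  elliptic curves, **Thm. 1.17-shaped density-`1` dichotomies for `E` and for its isogenous
  curve(s), together with the second equality of Prop. 1.18, give "`r_{2^∞}(E^d) ≤ 1` for `100 %`
  of the squarefree `d`"** — the core of Thm. 1.7; the first equality of Prop. 1.18 is the tree
  theorem `selmerCorankTwoInfty_quadraticTwist_intCast_eq_of_isIsogenous` and is *used*, not
  assumed;
* `smith_selmerCorank_density_of_isogenyTrick`, `smith_selmerCorank_density_of_isogenyTrick₂` —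
  hence, granted Modularity and Monsky's congruence (the tree's route to the parity half),
  `smith_selmerCorank_density` for `E` **and** for the isogenous curve(s).

Scope, stated plainly. The quantities `r_{φ,div}(E^d)` of Def. 1.16 (the `𝔽₂`-dimension of
`im(H¹(G_ℚ, E[φ]) → H¹(G_ℚ, E^d[2^∞])) ∩ Sel^{2^∞}_div E^d`) are **not** defined in the tree; the
theorems below quantify over arbitrary functions `a b : ℤ → ℕ` in their place and assume of them
exactly what the printed argument uses — the identity of Prop. 1.18 (`h₁₈`) and the dichotomies
of Thm. 1.17 (`h₁₇`, `h₁₇'`). Nothing here proves Thm. 1.17 (§§2–6 of the paper) or Prop. 1.18's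
second equality, and nothing here touches Cases I–II ([Smi22a]) — Thm. 1.1 itself remains the
cited named fact `smith_selmerCorank_density`.

## References

* [arXiv250317619] A. Smith, *The Birch and Swinnerton-Dyer conjecture implies Goldfeld's
  conjecture*, arXiv:2503.17619 (2025): §1.1 (Def. 1.6, Thm. 1.7), §1.2 (Def. 1.16, Thm. 1.17,
  Prop. 1.18, proof of Thm. 1.7).
* [Smi22a] A. Smith, *The distribution of `ℓ^∞`-Selmer groups in degree `ℓ` twist families I*,
  arXiv:2207.05674 (2022).
-/

noncomputable section

open scoped Classical

namespace Literature.NumberTheory.EllipticCurves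

/-! ## The bookkeeping of §1.2 in the abstract -/

section Abstract

/-- **Smith's isogeny trick, abstract form (Case IV shape)** (A. Smith, arXiv:2503.17619, §1.2,
proof of Thm. 1.7 from Thm. 1.17 and Prop. 1.18). Let `r, r₀, a, b : ℤ → ℕ` (in the source:
`r d = r_{2^∞}(E^d)`, `r₀ d = r_{2^∞}(E₀^d)`, `a d = r_{φ,div}(E^d)`, `b d = r_{φ',div}(E₀^d)` for a
degree-`2` `ℚ`-isogeny `φ : E → E₀` with dual `φ'`). Assume Prop. 1.18, `r d = r₀ d = a d + b d`
for `d ≠ 0` (`h₁₈`), and the two dichotomies of Thm. 1.17, each on a set of squarefree `d` of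
density `1`: "`r d ≤ 1` or `r d = a d ≥ 2`" (`h₁₇`, for `E`) and "`r₀ d ≤ 1` or `r₀ d = b d ≥ 2`"
(`h₁₇'`, for `E₀`). Then `r d ≤ 1` for a set of squarefree `d` of density `1`. Proof, as printed
(run forward instead of by contradiction): on the intersection of the two density-`1` sets
(`twistDensity.and_one`), `r d ≥ 2` would give `r d = a d`, hence `b d = 0`, while
`r₀ d = r d ≥ 2` gives `r₀ d = b d ≥ 2`. [cite: arXiv250317619, §1.2 (proof of Thm. 1.7)] -/
theorem twistDensity_le_one_of_rank_identity {r r₀ a b : ℤ → ℕ}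
    (h₁₈ : ∀ d : ℤ, d ≠ 0 → r d = r₀ d ∧ r d = a d + b d)
    (h₁₇ : twistDensity (fun d ↦ d ≠ 0 ∧ (r d ≤ 1 ∨ (r d = a d ∧ 2 ≤ a d))) 1)
    (h₁₇' : twistDensity (fun d ↦ d ≠ 0 ∧ (r₀ d ≤ 1 ∨ (r₀ d = b d ∧ 2 ≤ b d))) 1) :
    twistDensity (fun d ↦ d ≠ 0 ∧ r d ≤ 1) 1 := by
  refine twistDensity_one_mono (fun d _ hd ↦ ?_) (h₁₇.and_one h₁₇')
  obtain ⟨⟨hd0, h⟩, -, h'⟩ := hd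
  obtain ⟨hr, hab⟩ := h₁₈ d hd0
  refine ⟨hd0, ?_⟩
  rcases h with h | ⟨hra, ha⟩
  · exact h
  · exfalso
    rcases h' with h' | ⟨hrb, hb⟩
    · omega
    · omega

/-- **Smith's isogeny trick, abstract form (Case V shape)** (A. Smith, arXiv:2503.17619, §1.2,
proof of Thm. 1.7 in Case V). Let `r, r₁, r₂, a₁, b₁, a₂, b₂ : ℤ → ℕ` (in the source:
`r d = r_{2^∞}(E^d)`, `rᵢ d = r_{2^∞}(Eᵢ^d)`, `aᵢ d = r_{φᵢ,div}(E^d)`, `bᵢ d = r_{φᵢ',div}(Eᵢ^d)` for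
the two balanced isogenies `φᵢ : E → Eᵢ` with duals `φᵢ'`). Assume Prop. 1.18 for `φ₁` and for
`φ₂` (`r d = rᵢ d = aᵢ d + bᵢ d` for `d ≠ 0`), the three-way dichotomy of Thm. 1.17 for `E` in
Case V ("`r d ≤ 1` or `r d = a₁ d ≥ 2` or `r d = a₂ d ≥ 2`" on a density-`1` set) and the Case IV
dichotomy of Thm. 1.17 for each `Eᵢ` ("`rᵢ d ≤ 1` or `rᵢ d = bᵢ d ≥ 2`" on a density-`1` set; by
[Chil21] the `Eᵢ` are in Case IV with balanced isogeny `φᵢ'`). Then `r d ≤ 1` on a set of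
squarefree `d` of density `1`: on the triple intersection, `r d = aᵢ d ≥ 2` gives `bᵢ d = 0`
against `rᵢ d = r d ≥ 2 ⇒ rᵢ d = bᵢ d ≥ 2`. [cite: arXiv250317619, §1.2 (proof of Thm. 1.7)] -/
theorem twistDensity_le_one_of_rank_identity₂ {r r₁ r₂ a₁ b₁ a₂ b₂ : ℤ → ℕ}
    (h₁₈₁ : ∀ d : ℤ, d ≠ 0 → r d = r₁ d ∧ r d = a₁ d + b₁ d)
    (h₁₈₂ : ∀ d : ℤ, d ≠ 0 → r d = r₂ d ∧ r d = a₂ d + b₂ d)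
    (h₁₇ : twistDensity (fun d ↦ d ≠ 0 ∧
      (r d ≤ 1 ∨ (r d = a₁ d ∧ 2 ≤ a₁ d) ∨ (r d = a₂ d ∧ 2 ≤ a₂ d))) 1)
    (h₁₇₁ : twistDensity (fun d ↦ d ≠ 0 ∧ (r₁ d ≤ 1 ∨ (r₁ d = b₁ d ∧ 2 ≤ b₁ d))) 1)
    (h₁₇₂ : twistDensity (fun d ↦ d ≠ 0 ∧ (r₂ d ≤ 1 ∨ (r₂ d = b₂ d ∧ 2 ≤ b₂ d))) 1) :
    twistDensity (fun d ↦ d ≠ 0 ∧ r d ≤ 1) 1 := by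
  refine twistDensity_one_mono (fun d _ hd ↦ ?_) ((h₁₇.and_one h₁₇₁).and_one h₁₇₂)
  obtain ⟨⟨⟨hd0, h⟩, -, h₁⟩, -, h₂⟩ := hd
  obtain ⟨hr₁, hab₁⟩ := h₁₈₁ d hd0
  obtain ⟨hr₂, hab₂⟩ := h₁₈₂ d hd0
  refine ⟨hd0, ?_⟩
  rcases h with h | ⟨hra, ha⟩ | ⟨hra, ha⟩
  · exact h
  · exfalso
    rcases h₁ with h₁ | ⟨hrb, hb⟩
    · omega
    · omega
  · exfalso
    rcases h₂ with h₂ | ⟨hrb, hb⟩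
    · omega
    · omega

end Abstract

/-! ## The isogeny trick for the tree's `r_{2^∞}` in quadratic twist families -/

section Concrete

open WeierstrassCurve Literature.NumberTheory.EllipticCurves.ModularForms

variable {W W₀ W₁ W₂ : WeierstrassCurve ℚ}

/-- **The core statement of Thm. 1.1 is an isogeny invariant** (A. Smith, arXiv:2503.17619,
§1.2, opening of the proof of Thm. 1.7: *"By considering the isogenous curve and applying
Proposition 1.18 if necessary, we may assume …"*; §1.1, Case III). For `ℚ`-isogenous elliptic
curves `E ∼ E₀`, "`r_{2^∞}(E^d) ≤ 1` for `100 %` of the squarefree `d`" holds for `E` iff it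
holds for `E₀`, since `r_{2^∞}(E^d) = r_{2^∞}(E₀^d)` for every `d ≠ 0` (Prop. 1.18, first
equality; tree: `selmerCorankTwoInfty_quadraticTwist_intCast_eq_of_isIsogenous`).
[cite: arXiv250317619, §1.2 (Prop. 1.18 and proof of Thm. 1.7)] -/
theorem twistDensity_selmerCorankTwoInfty_le_one_iff_of_isIsogenous [W.IsElliptic]
    [W₀.IsElliptic] (hiso : IsIsogenous W W₀) :
    twistDensity (fun d ↦ d ≠ 0 ∧ selmerCorankTwoInfty (W.quadraticTwist d) ≤ 1) 1 ↔
      twistDensity (fun d ↦ d ≠ 0 ∧ selmerCorankTwoInfty (W₀.quadraticTwist d) ≤ 1) 1 :=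
  twistDensity_congr (fun d _ ↦ and_congr_right fun hd ↦ by
    rw [selmerCorankTwoInfty_quadraticTwist_intCast_eq_of_isIsogenous hiso hd]) 1

/-- **Smith, arXiv:2503.17619, §1.2: Thm. 1.17 for `E` and `E₀` + Prop. 1.18 ⇒ the core of
Thm. 1.7 for `E` (Case IV shape).** Let `E = W`, `E₀ = W₀` be `ℚ`-isogenous elliptic curves and
let `a d`, `b d` (`d ∈ ℤ`) be natural numbers (in the source `a d = r_{φ,div}(E^d)`,
`b d = r_{φ',div}(E₀^d)` for the balanced isogeny `φ : E → E₀` and its dual, Def. 1.16 — not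
defined in the tree) satisfying the second equality of Prop. 1.18,
`r_{2^∞}(E^d) = a d + b d` for `d ≠ 0` (`h₁₈`; the first equality `r_{2^∞}(E^d) = r_{2^∞}(E₀^d)`
is the tree theorem `selmerCorankTwoInfty_quadraticTwist_intCast_eq_of_isIsogenous`). If, as
Thm. 1.17 asserts for a Case IV curve, for `100 %` of the squarefree `d` either
`r_{2^∞}(E^d) ≤ 1` or `r_{2^∞}(E^d) = a d ≥ 2` (`h₁₇`), and likewise for `E₀` with `b`
(`h₁₇'`), then **`r_{2^∞}(E^d) ≤ 1` for `100 %` of the squarefree `d`** — the statement to which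
Thm. 1.1 for `E` reduces in the tree (`smith_selmerCorank_density_iff_le_one_of_exists_isNewformOf`).
[cite: arXiv250317619, §1.2 (Thm. 1.17, Prop. 1.18, proof of Thm. 1.7)] -/
theorem twistDensity_selmerCorankTwoInfty_le_one_of_isogenyTrick [W.IsElliptic] [W₀.IsElliptic]
    (hiso : IsIsogenous W W₀) (a b : ℤ → ℕ)
    (h₁₈ : ∀ d : ℤ, d ≠ 0 → selmerCorankTwoInfty (W.quadraticTwist d) = a d + b d)
    (h₁₇ : twistDensity (fun d ↦ d ≠ 0 ∧
      (selmerCorankTwoInfty (W.quadraticTwist d) ≤ 1 ∨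
        (selmerCorankTwoInfty (W.quadraticTwist d) = a d ∧ 2 ≤ a d))) 1)
    (h₁₇' : twistDensity (fun d ↦ d ≠ 0 ∧
      (selmerCorankTwoInfty (W₀.quadraticTwist d) ≤ 1 ∨
        (selmerCorankTwoInfty (W₀.quadraticTwist d) = b d ∧ 2 ≤ b d))) 1) :
    twistDensity (fun d ↦ d ≠ 0 ∧ selmerCorankTwoInfty (W.quadraticTwist d) ≤ 1) 1 :=
  twistDensity_le_one_of_rank_identity (r := fun d : ℤ ↦ selmerCorankTwoInfty (W.quadraticTwist d))
    (r₀ := fun d : ℤ ↦ selmerCorankTwoInfty (W₀.quadraticTwist d))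
    (fun d hd ↦ ⟨selmerCorankTwoInfty_quadraticTwist_intCast_eq_of_isIsogenous hiso hd, h₁₈ d hd⟩)
    h₁₇ h₁₇'

/-- The same conclusion **for the isogenous curve `E₀`**: under the hypotheses of
`twistDensity_selmerCorankTwoInfty_le_one_of_isogenyTrick`, also `r_{2^∞}(E₀^d) ≤ 1` for `100 %`
of the squarefree `d`, by the isogeny invariance `r_{2^∞}(E^d) = r_{2^∞}(E₀^d)` (Prop. 1.18, first
equality). [cite: arXiv250317619, §1.2 (Prop. 1.18, proof of Thm. 1.7)] -/
theorem twistDensity_selmerCorankTwoInfty_le_one_of_isogenyTrick'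
    [W.IsElliptic] [W₀.IsElliptic] (hiso : IsIsogenous W W₀) (a b : ℤ → ℕ)
    (h₁₈ : ∀ d : ℤ, d ≠ 0 → selmerCorankTwoInfty (W.quadraticTwist d) = a d + b d)
    (h₁₇ : twistDensity (fun d ↦ d ≠ 0 ∧
      (selmerCorankTwoInfty (W.quadraticTwist d) ≤ 1 ∨
        (selmerCorankTwoInfty (W.quadraticTwist d) = a d ∧ 2 ≤ a d))) 1)
    (h₁₇' : twistDensity (fun d ↦ d ≠ 0 ∧
      (selmerCorankTwoInfty (W₀.quadraticTwist d) ≤ 1 ∨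
        (selmerCorankTwoInfty (W₀.quadraticTwist d) = b d ∧ 2 ≤ b d))) 1) :
    twistDensity (fun d ↦ d ≠ 0 ∧ selmerCorankTwoInfty (W₀.quadraticTwist d) ≤ 1) 1 :=
  (twistDensity_selmerCorankTwoInfty_le_one_iff_of_isIsogenous hiso).1
    (twistDensity_selmerCorankTwoInfty_le_one_of_isogenyTrick hiso a b h₁₈ h₁₇ h₁₇')

/-- **Smith, arXiv:2503.17619, §1.2: the isogeny trick in Case V shape.** Let `E = W` be an
elliptic curve, `ℚ`-isogenous to the elliptic curves `E₁ = W₁` and `E₂ = W₂` (in the source: the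
targets of its two balanced isogenies `φ₁`, `φ₂`, which are Case IV curves by [Chil21]), and let
`aᵢ d`, `bᵢ d` be natural numbers (in the source `r_{φᵢ,div}(E^d)`, `r_{φᵢ',div}(Eᵢ^d)`)
satisfying Prop. 1.18 for `φ₁` and `φ₂`: `r_{2^∞}(E^d) = aᵢ d + bᵢ d` for `d ≠ 0`. If for `100 %`
of the squarefree `d` "`r_{2^∞}(E^d) ≤ 1` or `r_{2^∞}(E^d) = a₁ d ≥ 2` or
`r_{2^∞}(E^d) = a₂ d ≥ 2`" (Thm. 1.17 for `E` in Case V, `h₁₇`) and, for `i = 1, 2`, for `100 %` of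
the squarefree `d` "`r_{2^∞}(Eᵢ^d) ≤ 1` or `r_{2^∞}(Eᵢ^d) = bᵢ d ≥ 2`" (Thm. 1.17 for `Eᵢ` in
Case IV, `h₁₇₁`, `h₁₇₂`), then **`r_{2^∞}(E^d) ≤ 1` for `100 %` of the squarefree `d`**.
[cite: arXiv250317619, §1.2 (Thm. 1.17, Prop. 1.18, proof of Thm. 1.7)] -/
theorem twistDensity_selmerCorankTwoInfty_le_one_of_isogenyTrick₂
    [W.IsElliptic] [W₁.IsElliptic] [W₂.IsElliptic]
    (hiso₁ : IsIsogenous W W₁) (hiso₂ : IsIsogenous W W₂) (a₁ b₁ a₂ b₂ : ℤ → ℕ)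
    (h₁₈₁ : ∀ d : ℤ, d ≠ 0 → selmerCorankTwoInfty (W.quadraticTwist d) = a₁ d + b₁ d)
    (h₁₈₂ : ∀ d : ℤ, d ≠ 0 → selmerCorankTwoInfty (W.quadraticTwist d) = a₂ d + b₂ d)
    (h₁₇ : twistDensity (fun d ↦ d ≠ 0 ∧
      (selmerCorankTwoInfty (W.quadraticTwist d) ≤ 1 ∨
        (selmerCorankTwoInfty (W.quadraticTwist d) = a₁ d ∧ 2 ≤ a₁ d) ∨
        (selmerCorankTwoInfty (W.quadraticTwist d) = a₂ d ∧ 2 ≤ a₂ d))) 1)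
    (h₁₇₁ : twistDensity (fun d ↦ d ≠ 0 ∧
      (selmerCorankTwoInfty (W₁.quadraticTwist d) ≤ 1 ∨
        (selmerCorankTwoInfty (W₁.quadraticTwist d) = b₁ d ∧ 2 ≤ b₁ d))) 1)
    (h₁₇₂ : twistDensity (fun d ↦ d ≠ 0 ∧
      (selmerCorankTwoInfty (W₂.quadraticTwist d) ≤ 1 ∨
        (selmerCorankTwoInfty (W₂.quadraticTwist d) = b₂ d ∧ 2 ≤ b₂ d))) 1) :
    twistDensity (fun d ↦ d ≠ 0 ∧ selmerCorankTwoInfty (W.quadraticTwist d) ≤ 1) 1 :=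
  twistDensity_le_one_of_rank_identity₂
    (r := fun d : ℤ ↦ selmerCorankTwoInfty (W.quadraticTwist d))
    (r₁ := fun d : ℤ ↦ selmerCorankTwoInfty (W₁.quadraticTwist d))
    (r₂ := fun d : ℤ ↦ selmerCorankTwoInfty (W₂.quadraticTwist d))
    (fun d hd ↦ ⟨selmerCorankTwoInfty_quadraticTwist_intCast_eq_of_isIsogenous hiso₁ hd, h₁₈₁ d hd⟩)
    (fun d hd ↦ ⟨selmerCorankTwoInfty_quadraticTwist_intCast_eq_of_isIsogenous hiso₂ hd, h₁₈₂ d hd⟩)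
    h₁₇ h₁₇₁ h₁₇₂

/-! ### With the parity half: Thm. 1.1 for `E` and for the isogenous curves -/

/-- **Thm. 1.7 ⇒ Thm. 1.1 along the tree's reduction, Case IV shape.** Granted the Modularity
Theorem (`hmod`) and Monsky's `2`-parity congruence (`hMon`), which supply the parity half of
Thm. 1.1 in the tree (`smith_selmerCorank_density_of_le_one`), the Thm. 1.17-shaped inputs for
`E` and `E₀` and Prop. 1.18 (as in `twistDensity_selmerCorankTwoInfty_le_one_of_isogenyTrick`)
give Smith's Thm. 1.1 for `E`: `smith_selmerCorank_density W`.
[cite: arXiv250317619, §1.2 (proof of Thm. 1.7) and Thm. 1.1] -/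
theorem smith_selmerCorank_density_of_isogenyTrick [W.IsElliptic] [W₀.IsElliptic]
    (hmod : exists_isNewformOf) (hMon : monsky_selmerCorank_two_mod_two_eq)
    (hiso : IsIsogenous W W₀) (a b : ℤ → ℕ)
    (h₁₈ : ∀ d : ℤ, d ≠ 0 → selmerCorankTwoInfty (W.quadraticTwist d) = a d + b d)
    (h₁₇ : twistDensity (fun d ↦ d ≠ 0 ∧
      (selmerCorankTwoInfty (W.quadraticTwist d) ≤ 1 ∨
        (selmerCorankTwoInfty (W.quadraticTwist d) = a d ∧ 2 ≤ a d))) 1)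
    (h₁₇' : twistDensity (fun d ↦ d ≠ 0 ∧
      (selmerCorankTwoInfty (W₀.quadraticTwist d) ≤ 1 ∨
        (selmerCorankTwoInfty (W₀.quadraticTwist d) = b d ∧ 2 ≤ b d))) 1) :
    smith_selmerCorank_density W ∧ smith_selmerCorank_density W₀ :=
  have hW : smith_selmerCorank_density W :=
    smith_selmerCorank_density_of_le_one W hmod hMon
      (twistDensity_selmerCorankTwoInfty_le_one_of_isogenyTrick hiso a b h₁₈ h₁₇ h₁₇')
  ⟨hW, (smith_selmerCorank_density_iff_of_isIsogenous hiso).1 hW⟩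

/-- **Thm. 1.7 ⇒ Thm. 1.1 along the tree's reduction, Case V shape.** Granted Modularity and
Monsky's congruence, the Thm. 1.17-shaped inputs for `E` (Case V, isogenies to `E₁`, `E₂`) and
for `E₁`, `E₂`, with Prop. 1.18 for both isogenies (as in
`twistDensity_selmerCorankTwoInfty_le_one_of_isogenyTrick₂`), give Smith's Thm. 1.1 for `E`,
`E₁` and `E₂`. [cite: arXiv250317619, §1.2 (proof of Thm. 1.7) and Thm. 1.1] -/
theorem smith_selmerCorank_density_of_isogenyTrick₂
    [W.IsElliptic] [W₁.IsElliptic] [W₂.IsElliptic]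
    (hmod : exists_isNewformOf) (hMon : monsky_selmerCorank_two_mod_two_eq)
    (hiso₁ : IsIsogenous W W₁) (hiso₂ : IsIsogenous W W₂) (a₁ b₁ a₂ b₂ : ℤ → ℕ)
    (h₁₈₁ : ∀ d : ℤ, d ≠ 0 → selmerCorankTwoInfty (W.quadraticTwist d) = a₁ d + b₁ d)
    (h₁₈₂ : ∀ d : ℤ, d ≠ 0 → selmerCorankTwoInfty (W.quadraticTwist d) = a₂ d + b₂ d)
    (h₁₇ : twistDensity (fun d ↦ d ≠ 0 ∧
      (selmerCorankTwoInfty (W.quadraticTwist d) ≤ 1 ∨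
        (selmerCorankTwoInfty (W.quadraticTwist d) = a₁ d ∧ 2 ≤ a₁ d) ∨
        (selmerCorankTwoInfty (W.quadraticTwist d) = a₂ d ∧ 2 ≤ a₂ d))) 1)
    (h₁₇₁ : twistDensity (fun d ↦ d ≠ 0 ∧
      (selmerCorankTwoInfty (W₁.quadraticTwist d) ≤ 1 ∨
        (selmerCorankTwoInfty (W₁.quadraticTwist d) = b₁ d ∧ 2 ≤ b₁ d))) 1)
    (h₁₇₂ : twistDensity (fun d ↦ d ≠ 0 ∧
      (selmerCorankTwoInfty (W₂.quadraticTwist d) ≤ 1 ∨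
        (selmerCorankTwoInfty (W₂.quadraticTwist d) = b₂ d ∧ 2 ≤ b₂ d))) 1) :
    smith_selmerCorank_density W ∧ smith_selmerCorank_density W₁ ∧
      smith_selmerCorank_density W₂ :=
  have hW : smith_selmerCorank_density W :=
    smith_selmerCorank_density_of_le_one W hmod hMon
      (twistDensity_selmerCorankTwoInfty_le_one_of_isogenyTrick₂ hiso₁ hiso₂ a₁ b₁ a₂ b₂
        h₁₈₁ h₁₈₂ h₁₇ h₁₇₁ h₁₇₂)
  ⟨hW, (smith_selmerCorank_density_iff_of_isIsogenous hiso₁).1 hW,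
    (smith_selmerCorank_density_iff_of_isIsogenous hiso₂).1 hW⟩

end Concrete

end Literature.NumberTheory.EllipticCurves

end
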